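import Summits.ResolutionOfSingularities.ResolutionOfSingularities.Theorems.WeightedInvariantIota3SteepPinning
import HarnessLib

/-!
# (STEEP), step 2 — ONLY `W`-LED FLAGS CAN BE STEEP: a steep one-flag reach of `g = c·W^ν + t⁻¹·H` at the pinned successor is led by
# `g₁ = α t⁻¹ + γ z + δ W` with `γ ∈ 𝔪` AND `δ` A UNIT (door `HypersurfaceCentreConstruction`, stmt-ResolutionOfSingularities-19897)

Helper for `stub_keyRungGrHomLE_three` (def-free, `--supports 19897`).  Sequel of …Iota3SteepPinning (`γ ∈ 𝔪`, the cofactor is a unit).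

* **`Iota3.ratContactFiltration_le_pow_succ_of_lt`** — for ANY `g₁ ∈ 𝔪` and `0 < b < a`, `ν ≥ 1`: the pieces `α < ν` of
  `ratContactFiltration g₁ a b (aν)` lie in `𝔪^{ν+1}` (R9's `succ_le_add_ceil`); so a steep reach is carried by the pieces `α ≥ ν`, i.e. by `(g₁^ν)`.
* **`Iota3.not_mem_ratContactFiltration_of_mem_sq`** — a first member `g₁ ∈ 𝔪²` carries NO steep reach of an element of order `ν`
  (`ν ≥ 1`): then `(g₁^ν) ⊆ 𝔪^{2ν} ⊆ 𝔪^{ν+1}` too.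
* **`Iota3.isUnit_coeff_W_of_steep`** — **`T`-led flags are never steep**: with `𝔪 = (T, z, W)` (regular local threefold), `g = c W^ν + T H`,
  `c` a unit, a tangent-cone approximation `g − c₁ g₁^ν ∈ 𝔪^{ν+1}` along `g₁ = α T + γ z + δ W` with `γ ∈ 𝔪` forces `δ ∉ 𝔪` (weights
  `(ν+1, 1, 1)`: if `δ ∈ 𝔪` then `g₁ ∈ 𝒥₂`, `g₁^ν ∈ 𝒥_{2ν} ⊆ 𝒥_{ν+1}`, so `c W^ν ∈ 𝒥_{1·ν+1}`, contradicting quasi-regularity).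
* **`Iota3.steep_pinning`** — THE PINNING THEOREM: a steep reach `c W^ν + T H ∈ ratContactFiltration (αT + γz + δW) a b (aν)`, `0 < b < a`,
  `ν ≥ 1`, forces `γ ∈ 𝔪` and `IsUnit δ`: the flag is `W`-LED.  What remains of (STEEP) is the `W`-led case
  (`g₁ = δ W + α T + γ z`, `δ` unit, `γ ∈ 𝔪`): SIGMA-ISO.md §2 (b), push-down to the pair `(y − x^b φ, x)` of `S_P`.

[OURS · L1 W4.3 · kernel lemmas; AI work, weaker than expert review; nothing here is a statement of the manuscript under review
(Hironaka 2017, [claim: Hironaka2017, status: under-review]).]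

## References

* H. Matsumura, *Commutative Ring Theory*, CUP 1986, Thm. 16.2 (quasi-regularity). [Matsumura1987]
* H. Hironaka, *Characteristic polyhedra of singularities*, J. Math. Kyoto Univ. 7 (1967), §3. [Hironaka1967]
-/

noncomputable section

set_option linter.dupNamespace false -- mandated namespace of this single-conjunct summit

open IsLocalRing Literature.AlgebraicGeometry.Resolution
open Summit.ResolutionOfSingularities.ResolutionOfSingularities.Theorems
open Summit.ResolutionOfSingularities.ResolutionOfSingularities.Cruxes.HypersurfaceCentreConstruction.LocalEngine.Iota3.RatContact

namespace Summit.ResolutionOfSingularities.ResolutionOfSingularities.Cruxes.HypersurfaceCentreConstruction.LocalEngine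

namespace Iota3

section Steep

variable {L : Type} [CommRing L]

/-- **The low pieces of a steep filtration are deep**: for `g₁ ∈ 𝔪`, `0 < b < a`, every piece `α < ν` of `ratContactFiltration g₁ a b (aν)` lies in
`𝔪^{ν+1}`; hence `ratContactFiltration g₁ a b (aν) ≤ (g₁^ν) ⊔ 𝔪^{ν+1}` (R9's tangent-cone dichotomy) and, if moreover `g₁ ∈ 𝔪²` and `ν ≥ 1`,
`ratContactFiltration g₁ a b (aν) ≤ 𝔪^{ν+1}`. [folklore] -/
theorem ratContactFiltration_le_pow_succ_of_mem_sq [IsLocalRing L] {g₁ : L} (hg₁ : g₁ ∈ maximalIdeal L ^ 2) {a b ν : ℕ} (hb : 0 < b)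
    (hab : b < a) (hν : 1 ≤ ν) : ratContactFiltration g₁ a b (a * ν) ≤ maximalIdeal L ^ (ν + 1) := by
  have hg₁' : g₁ ∈ maximalIdeal L := by
    have h := Ideal.pow_le_pow_right (show 1 ≤ 2 by norm_num) hg₁
    rwa [pow_one] at h
  rw [ratContactFiltration_def]
  refine iSup_le fun α => ?_
  by_cases hα : ν ≤ α
  · calc Ideal.span {g₁ ^ α} * maximalIdeal L ^ ((a * ν - a * α + b - 1) / b) ≤ Ideal.span {g₁ ^ α} := Ideal.mul_le_right
      _ ≤ maximalIdeal L ^ (2 * α) := by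
          rw [Ideal.span_singleton_le_iff_mem, pow_mul]
          exact Ideal.pow_mem_pow hg₁ α
      _ ≤ maximalIdeal L ^ (ν + 1) := Ideal.pow_le_pow_right (by omega)
  · have hα : α < ν := Nat.lt_of_not_le hα
    calc Ideal.span {g₁ ^ α} * maximalIdeal L ^ ((a * ν - a * α + b - 1) / b)
        ≤ maximalIdeal L ^ α * maximalIdeal L ^ ((a * ν - a * α + b - 1) / b) :=
          Ideal.mul_mono_left ((Ideal.span_singleton_le_iff_mem _).mpr (Ideal.pow_mem_pow hg₁' α))
      _ = maximalIdeal L ^ (α + (a * ν - a * α + b - 1) / b) := (pow_add _ _ _).symm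
      _ ≤ maximalIdeal L ^ (ν + 1) := Ideal.pow_le_pow_right (succ_le_add_ceil hb hab hα)

/-- **A first member in `𝔪²` carries no steep reach of an element of order `ν`** (`g ∉ 𝔪^{ν+1}`, `ν ≥ 1`, `0 < b < a`). [folklore] -/
theorem not_mem_ratContactFiltration_of_mem_sq [IsLocalRing L] {g g₁ : L} (hg₁ : g₁ ∈ maximalIdeal L ^ 2) {a b ν : ℕ} (hb : 0 < b)
    (hab : b < a) (hν : 1 ≤ ν) (hg : g ∉ maximalIdeal L ^ (ν + 1)) : g ∉ ratContactFiltration g₁ a b (a * ν) := fun h =>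
  hg (ratContactFiltration_le_pow_succ_of_mem_sq hg₁ hb hab hν h)

variable [IsRegularLocalRing L]

/-- **`T`-led flags are never steep**: `𝔪 = (T, z, W)` in a regular local threefold, `g = c W^ν + T H` with `c` a unit, `ν ≥ 1`, and a
tangent-cone approximation `g − c₁ g₁^ν ∈ 𝔪^{ν+1}` along `g₁ = α T + γ z + δ W` with `γ ∈ 𝔪`: then `δ` is a unit.
[OURS · L1 W4.3 · (STEEP) step 2] [cite: Matsumura1987, Thm. 16.2] -/
theorem isUnit_coeff_W_of_steep (hdim : ringKrullDim L = (3 : ℕ)) {T z W c H α γ δ c₁ : L}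
    (hspan : Ideal.span {T, z, W} = maximalIdeal L) (hc : IsUnit c) {ν : ℕ} (hν : 1 ≤ ν) (hγ : γ ∈ maximalIdeal L)
    (h : c * W ^ ν + T * H - c₁ * (α * T + γ * z + δ * W) ^ ν ∈ maximalIdeal L ^ (ν + 1)) : IsUnit δ := by
  classical
  by_contra hδ
  have hδm : δ ∈ maximalIdeal L := (IsLocalRing.mem_maximalIdeal δ).mpr hδ
  have hu : Ideal.span (Set.range ![T, z, W]) = maximalIdeal L := by rw [range_three]; exact hspan
  have hw : ∀ i, 0 < (![ν + 1, 1, 1] : Fin 3 → ℕ) i := fun i => by fin_cases i <;> simp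
  have hzm : z ∈ maximalIdeal L := hspan ▸ Ideal.subset_span (by simp)
  have hWm : W ∈ maximalIdeal L := hspan ▸ Ideal.subset_span (by simp)
  set J := weightedMonomialIdeal ![T, z, W] ![ν + 1, 1, 1] with hJ
  have hpow2 : maximalIdeal L ^ 2 ≤ J 2 := pow_le_weightedMonomialIdeal_of_span_eq _ _ hw hu 2
  have hle : maximalIdeal L ^ (ν + 1) ≤ J (ν + 1) := pow_le_weightedMonomialIdeal_of_span_eq _ _ hw hu (ν + 1)
  have hT : T ∈ J (ν + 1) := self_mem_weightedMonomialIdeal ![T, z, W] ![ν + 1, 1, 1] 0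
  -- `g₁ ∈ J 2`
  have hg₁ : α * T + γ * z + δ * W ∈ J 2 := by
    refine Ideal.add_mem _ (Ideal.add_mem _ ?_ (hpow2 ?_)) (hpow2 ?_)
    · exact Ideal.mul_mem_left _ _ (weightedMonomialIdeal_antitone _ _ (show 2 ≤ ν + 1 by omega) hT)
    · rw [pow_two]; exact Ideal.mul_mem_mul hγ hzm
    · rw [pow_two]; exact Ideal.mul_mem_mul hδm hWm
  have hg₁ν : c₁ * (α * T + γ * z + δ * W) ^ ν ∈ J (ν + 1) := by
    refine Ideal.mul_mem_left _ _ (weightedMonomialIdeal_antitone _ _ (show ν + 1 ≤ 2 * ν by omega) ?_)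
    exact Summit.ResolutionOfSingularities.ResolutionOfSingularities.Theorems.pow_mem_weightedMonomialIdeal ![T, z, W] ![ν + 1, 1, 1] hg₁ ν
  have hmono : c * W ^ ν ∈ weightedMonomialIdeal ![T, z, W] ![ν + 1, 1, 1] ((![ν + 1, 1, 1] : Fin 3 → ℕ) 2 * ν + 1) := by
    rw [show (![ν + 1, 1, 1] : Fin 3 → ℕ) 2 * ν + 1 = ν + 1 by simp]
    have h1 : c * W ^ ν = (c * W ^ ν + T * H - c₁ * (α * T + γ * z + δ * W) ^ ν) + c₁ * (α * T + γ * z + δ * W) ^ ν - T * H := by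
      ring
    rw [h1]
    exact Ideal.sub_mem _ (Ideal.add_mem _ (hle h) hg₁ν) (Ideal.mul_mem_right _ _ hT)
  have hcm : c ∈ maximalIdeal L := mem_maximalIdeal_of_monomial_mem ![T, z, W] hu hdim ![ν + 1, 1, 1] hw 2 ν hmono
  exact ((IsLocalRing.mem_maximalIdeal c).mp hcm) hc

/-- **THE PINNING THEOREM — steep flags of the transform are `W`-led**: `𝔪 = (T, z, W)` in a regular local threefold, `g = c W^ν + T H` with `c`
a unit, `ν ≥ 1`; a steep one-flag reach `g ∈ ratContactFiltration (α T + γ z + δ W) a b (aν)`, `0 < b < a`, forces `γ ∈ 𝔪` AND `IsUnit δ`.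
[OURS · L1 W4.3 · (STEEP) steps 1–2] [cite: Hironaka1967, §3] -/
theorem steep_pinning (hdim : ringKrullDim L = (3 : ℕ)) {T z W c H α γ δ : L} (hspan : Ideal.span {T, z, W} = maximalIdeal L)
    (hc : IsUnit c) {ν a b : ℕ} (hν : 1 ≤ ν) (hb : 0 < b) (hab : b < a)
    (hreach : c * W ^ ν + T * H ∈ ratContactFiltration (α * T + γ * z + δ * W) a b (a * ν)) : γ ∈ maximalIdeal L ∧ IsUnit δ := by
  have hTm : T ∈ maximalIdeal L := hspan ▸ Ideal.subset_span (by simp)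
  have hzm : z ∈ maximalIdeal L := hspan ▸ Ideal.subset_span (by simp)
  have hWm : W ∈ maximalIdeal L := hspan ▸ Ideal.subset_span (by simp)
  have hg₁ : α * T + γ * z + δ * W ∈ maximalIdeal L :=
    Ideal.add_mem _ (Ideal.add_mem _ (Ideal.mul_mem_left _ _ hTm) (Ideal.mul_mem_left _ _ hzm)) (Ideal.mul_mem_left _ _ hWm)
  obtain ⟨c₁, hc₁⟩ := exists_sub_mul_pow_mem_of_mem_ratContactFiltration hg₁ hb hab hreach
  have hγ := coeff_z_mem_maximalIdeal_of_steep hdim hspan hc hν hc₁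
  exact ⟨hγ, isUnit_coeff_W_of_steep hdim hspan hc hν hγ hc₁⟩

end Steep

end Iota3

end Summit.ResolutionOfSingularities.ResolutionOfSingularities.Cruxes.HypersurfaceCentreConstruction.LocalEngine

end
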